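import Mathlib.Analysis.Complex.ExponentialBounds
import Mathlib.Analysis.Real.Pi.Bounds
import Literature.NumberTheory.LFunctions.NicolasMertensRH
import HarnessLib

/-!
# Robin's theorem at colossally abundant numbers: the analytic estimate (Robin 1984, §3)

Topic: `Literature/NumberTheory/LFunctions`. Pure proof file (no definition, nothing asserted),
serving provefact `Literature.NumberTheory.LFunctions.robin_iff` (`RHClassicalEquivalents.lean`; architecture in
`RobinCriterion.lean`). It proves the analytic heart of Robin's `RH ⟹ σ(N) < e^γ N log log N`
at colossally abundant `N` from the two prime-number inputs vendored in `NicolasMertensRH.lean`: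

* `Literature.NumberTheory.LFunctions.Nicolas2012_logf_lower` (Nicolas 2012, Prop. 2.1: under RH, for `x ≥ 10⁹`,
  `∏_{p≤x}(1 − 1/p)⁻¹ ≤ e^γ log θ(x) · exp((2+β)/(√x log x))`, `β = 2 + γ − log 4π`), and
* `Literature.NumberTheory.LFunctions.Schoenfeld1976_theta` (under RH, `|θ(x) − x| ≤ √x log²x/(8π)` for `x ≥ 599`).

**Main results.**

* `RobinAnalytic.mertens_prod_lt`: under RH and the two facts, for naturals `Q ≤ P` with
  `P ≥ 2·10¹⁰`,
  `(∏_{p≤P}(1 − 1/p))⁻¹ · ∏_{Q<p≤P}(1 − 1/p²) < e^γ · log(θ(P) + θ(Q))`.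
  With Robin's bound `σ(N)/N ≤ ∏_{x₂<p≤x₁}(1 − 1/p²) ∏_{p≤x₁}(1 − 1/p)⁻¹` and
  `log N ≥ θ(x₁) + θ(x₂)` for a colossally abundant `N` (`ColossallyAbundantExponents.lean`),
  this is Robin's inequality at `N` as soon as its largest prime `x₁ = P ≥ 2·10¹⁰`.
* `RobinAnalytic.theta_add_size_le`: under RH, `θ(P) + √u log u ≤ 10¹⁰ log 10` for
  `P < 2·10¹⁰`, `u = (2P+1) log(2P)/log 2` — so the colossally abundant numbers with
  `P < 2·10¹⁰` are `≤ 10^(10^10)`, inside the range verified by Briggs (2006)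
  (`Literature.NumberTheory.LFunctions.Briggs2006_robinInequality_le`).

**The argument** (Robin 1984, §3, with Nicolas's constants; all second-order terms explicit).
Put `L = log P`, `E = (2+β)/(√P L)`, `S = ∑_{Q<p≤P} 1/p²`, `A = log θ(P)`, `R = θ(P) + θ(Q)`.
Nicolas gives `∏(1−1/p)⁻¹ ≤ e^γ A e^E`; `∏(1 − 1/p²) ≤ e^{−S}`; and
`log(log R) − log A ≥ (log R − A)/log R ≥ θ(Q)/(R log R) =: G` (twice `log x ≥ 1 − 1/x`). So it
suffices that `E < S + G` (`key_ineq`), and `2 + β < 2.1002` (`γ < H₆₄ − log 64`, `log π > log 3`).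
Three regimes, with Schoenfeld's bound in the form `0.975 t ≤ θ(t) ≤ 1.025 t` (`t ≥ 2¹⁵`) and
`|θ(t) − t| ≤ 0.0002 t` (`t ≥ 2³⁴`), the monotonicity of `log²t/√t` being proved through
`u²e^{−u}` (`sq_mul_exp_neg_antitone`):
(A) `Q ≥ 5√P`: `G ≥ 2.36/(√P L)`.
(B) `Q ≤ √P/4`: `S ≥ 5.8/(√P L)` from the primes in `(y, 20y]`, `y = ⌊√P/4⌋`.
(C) between: `G ≥ 0.9747 Q/(P L)` and `S ≥ 1.19/(Q L)` (window `(Q, 20Q]`), and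
`0.9747 Q² − 2.1002 Q√P + 1.19 P > 0`.
The window sums are bounded below by a discrete layer-cake (`layer_cake`:
`∑_{y<p≤z} 1/p² ≥ ∑_{y<n≤z} d(n) #{y < p ≤ n}`, `d(n) = 2/(n(n+1)(n+2))`) and
`#{y < p ≤ n} log n ≥ θ(n) − θ(y)`, giving `S ≥ 0.827/(y log 20y)` (`window_bound`).
Robin's own route (his lemma for `x ≥ 20000` and a table of colossally abundant numbers below)
is replaced by Nicolas's `x₀ = 10⁹` and Briggs's computation, which the threshold `2·10¹⁰`
matches.

## References

* G. Robin, *Grandes valeurs de la fonction somme des diviseurs et hypothèse de Riemann*,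
  J. Math. Pures Appl. 63 (1984), 187–213, §3. [Robin1984]
* J.-L. Nicolas, Acta Arith. 155 (2012), 311–321, Prop. 2.1, (1.12), (1.14). [Nicolas2012]
* L. Schoenfeld, Math. Comp. 30 (1976), 337–360, §6. [Schoenfeld1976]
* K. Briggs, Experiment. Math. 15 (2006), 251–256. [Briggs2006]
-/

noncomputable section

open Real Filter Finset
open scoped Chebyshev

namespace Literature.NumberTheory.LFunctions


namespace RobinAnalytic

/-! ### Numerical constants -/

/-- `H₆₄ < 4.743891` (exact rational computation). [folklore] -/
theorem harmonic_64_lt : harmonic 64 < 4743891 / 1000000 := by decide +kernel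

/-- `γ < 0.585008` (from `γ < H₆₄ − log 64`; the true value is `0.5772…`). [folklore] -/
theorem eulerMascheroniConstant_lt : eulerMascheroniConstant < 0.585008 := by
  have h := Real.eulerMascheroniConstant_lt_eulerMascheroniSeq' 64
  have hH : ((harmonic 64 : ℚ) : ℝ) < ((4743891 / 1000000 : ℚ) : ℝ) := Rat.cast_lt.2 harmonic_64_lt
  have hlog : Real.log ((64 : ℕ) : ℝ) = 6 * Real.log 2 := by
    rw [show ((64 : ℕ) : ℝ) = 2 ^ 6 by norm_num, Real.log_pow]
    norm_num
  unfold Real.eulerMascheroniSeq' at h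
  rw [if_neg (by norm_num), hlog] at h
  have h2 := Real.log_two_gt_d9
  push_cast at hH
  linarith

/-- `2 + β < 2.1002` where `β = 2 + γ − log π − 2 log 2 = 0.046…` (`log π > log 3`).
[cite: Nicolas2012, (1.3)] -/
theorem two_add_nicolasBeta_lt : 2 + nicolasBeta < 2.1002 := by
  unfold nicolasBeta
  have h1 := eulerMascheroniConstant_lt
  have h2 := Real.log_two_gt_d9
  have h3 : Real.log 3 ≤ Real.log π := Real.log_le_log (by norm_num) Real.pi_gt_three.le
  have h4 := Real.log_three_gt_d9
  linarith

/-- `log 10 > 2.3025850925`. [folklore] -/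
theorem log_ten_gt : (2.3025850925 : ℝ) < Real.log 10 := by
  rw [show (10 : ℝ) = 2 * 5 by norm_num, Real.log_mul (by norm_num) (by norm_num)]
  have h2 := Real.log_two_gt_d9
  have h5 := Real.log_five_gt_d9
  linarith

/-- `log 10 < 2.3025850935`. [folklore] -/
theorem log_ten_lt : Real.log 10 < 2.3025850935 := by
  rw [show (10 : ℝ) = 2 * 5 by norm_num, Real.log_mul (by norm_num) (by norm_num)]
  have h2 := Real.log_two_lt_d9
  have h5 := Real.log_five_lt_d9
  linarith

/-- `log (2·10¹⁰) > 23.718`. [folklore] -/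
theorem log_2e10_gt : (23.718 : ℝ) < Real.log (2 * 10 ^ 10) := by
  rw [Real.log_mul (by norm_num) (by norm_num), Real.log_pow]
  have h2 := Real.log_two_gt_d9
  have h10 := log_ten_gt
  push_cast
  linarith

/-- `√(2·10¹⁰) ≥ 141421`. [folklore] -/
theorem sqrt_2e10_ge : (141421 : ℝ) ≤ √(2 * 10 ^ 10) :=
  Real.le_sqrt_of_sq_le (by norm_num)

/-! ### `t ↦ log² t/√t` is decreasing for `t ≥ e⁴` -/

/-- For `2 ≤ u ≤ v`: `v² e^{−v} ≤ u² e^{−u}` (since `v/u ≤ 1 + (v−u)/2 ≤ e^{(v−u)/2}`). [folklore] -/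
theorem sq_mul_exp_neg_antitone {u v : ℝ} (hu : 2 ≤ u) (huv : u ≤ v) :
    v ^ 2 * rexp (-v) ≤ u ^ 2 * rexp (-u) := by
  have hu0 : 0 < u := by linarith
  have h1 : v ≤ u * rexp ((v - u) / 2) := by
    have h := Real.add_one_le_exp ((v - u) / 2)
    have : v ≤ u * ((v - u) / 2 + 1) := by nlinarith
    exact this.trans (mul_le_mul_of_nonneg_left h hu0.le)
  have hv0 : 0 ≤ v := by linarith
  have h2 : v ^ 2 ≤ u ^ 2 * rexp (v - u) := by
    have := mul_le_mul h1 h1 hv0 (by positivity)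
    calc v ^ 2 = v * v := sq v
      _ ≤ u * rexp ((v - u) / 2) * (u * rexp ((v - u) / 2)) := this
      _ = u ^ 2 * (rexp ((v - u) / 2) * rexp ((v - u) / 2)) := by ring
      _ = u ^ 2 * rexp (v - u) := by rw [← Real.exp_add]; ring_nf
  have h3 : rexp (v - u) = rexp v * rexp (-u) := by rw [← Real.exp_add]; ring_nf
  rw [h3] at h2
  have hev : 0 < rexp v := Real.exp_pos v
  calc v ^ 2 * rexp (-v) = v ^ 2 / rexp v := by rw [Real.exp_neg, div_eq_mul_inv]
    _ ≤ u ^ 2 * (rexp v * rexp (-u)) / rexp v := by gcongr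
    _ = u ^ 2 * rexp (-u) := by field_simp

/-- `log² t /√t ≤ log² s/√s` for `e⁴ ≤ s ≤ t` (Nicolas 2012, (1.14): `t ↦ log^a t/t^b` is
decreasing for `t > e^{a/b}`). [cite: Nicolas2012, (1.14)] -/
theorem log_sq_div_sqrt_antitone {s t : ℝ} (hs : rexp 4 ≤ s) (hst : s ≤ t) :
    Real.log t ^ 2 / √t ≤ Real.log s ^ 2 / √s := by
  have hs0 : 0 < s := (Real.exp_pos 4).trans_le hs
  have ht0 : 0 < t := hs0.trans_le hst
  have hsqrt : ∀ {x : ℝ}, 0 < x → √x = rexp (Real.log x / 2) := by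
    intro x hx
    rw [Real.sqrt_eq_rpow, Real.rpow_def_of_pos hx]
    ring_nf
  have hu : 2 ≤ Real.log s / 2 := by
    have : 4 ≤ Real.log s := by
      rw [← Real.log_exp 4]
      exact Real.log_le_log (Real.exp_pos 4) hs
    linarith
  have huv : Real.log s / 2 ≤ Real.log t / 2 := by
    have := Real.log_le_log hs0 hst
    linarith
  have key := sq_mul_exp_neg_antitone hu huv
  rw [hsqrt hs0, hsqrt ht0]
  have e1 : ∀ x : ℝ, Real.log x ^ 2 / rexp (Real.log x / 2) =
      4 * ((Real.log x / 2) ^ 2 * rexp (-(Real.log x / 2))) := by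
    intro x
    rw [Real.exp_neg, div_eq_mul_inv]
    ring
  rw [e1, e1]
  linarith

/-- `e⁴ ≤ 2¹⁵`. [folklore] -/
theorem exp_four_le : rexp 4 ≤ (2 : ℝ) ^ 15 := by
  have h := Real.exp_one_lt_d9
  have : rexp 4 = rexp 1 ^ 4 := by rw [← Real.exp_nat_mul]; norm_num
  rw [this]
  have h0 : 0 ≤ rexp 1 := (Real.exp_pos 1).le
  calc rexp 1 ^ 4 ≤ (2.7182818286 : ℝ) ^ 4 := by gcongr
    _ ≤ 2 ^ 15 := by norm_num

/-- Schoenfeld's error relative to `t`: `√t log² t/(8π) ≤ 0.025 t` for `t ≥ 2¹⁵`. [folklore] -/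
theorem schoenfeld_rel_le_025 {t : ℝ} (ht : (2 : ℝ) ^ 15 ≤ t) :
    √t * Real.log t ^ 2 / (8 * π) ≤ 0.025 * t := by
  have ht0 : 0 < t := lt_of_lt_of_le (by norm_num) ht
  have hmono := log_sq_div_sqrt_antitone exp_four_le ht
  -- value at `2^15`: `log 2^15 = 15 log 2 ≤ 10.3973`, `√2^15 ≥ 181.019`
  have hlog : Real.log ((2 : ℝ) ^ 15) ≤ 10.3973 := by
    rw [Real.log_pow]
    have := Real.log_two_lt_d9
    push_cast
    linarith
  have hlog0 : 0 ≤ Real.log ((2 : ℝ) ^ 15) := by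
    rw [Real.log_pow]; have := Real.log_two_gt_d9; push_cast; positivity
  have hsq : (181.019 : ℝ) ≤ √((2 : ℝ) ^ 15) := Real.le_sqrt_of_sq_le (by norm_num)
  have hval : Real.log ((2 : ℝ) ^ 15) ^ 2 / √((2 : ℝ) ^ 15) ≤ 0.5973 := by
    rw [div_le_iff₀ (by positivity)]
    calc Real.log ((2 : ℝ) ^ 15) ^ 2 ≤ (10.3973 : ℝ) ^ 2 := by gcongr
      _ ≤ 0.5973 * 181.019 := by norm_num
      _ ≤ 0.5973 * √((2 : ℝ) ^ 15) := by gcongr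
  have hpi : (3.14 : ℝ) < π := Real.pi_gt_d2
  have hst : 0 < √t := Real.sqrt_pos.2 ht0
  -- `√t log²t = t · (log² t/√t)`
  have hid : √t * Real.log t ^ 2 = t * (Real.log t ^ 2 / √t) := by
    field_simp
    rw [Real.sq_sqrt ht0.le]
    ring
  rw [hid, div_le_iff₀ (by positivity)]
  have hφ : Real.log t ^ 2 / √t ≤ 0.5973 := hmono.trans hval
  nlinarith

/-- `√t log² t/(8π) ≤ 0.0002 t` for `t ≥ 2³⁴`. [folklore] -/
theorem schoenfeld_rel_le_0002 {t : ℝ} (ht : (2 : ℝ) ^ 34 ≤ t) :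
    √t * Real.log t ^ 2 / (8 * π) ≤ 0.0002 * t := by
  have ht0 : 0 < t := lt_of_lt_of_le (by norm_num) ht
  have h34 : rexp 4 ≤ (2 : ℝ) ^ 34 := exp_four_le.trans (by norm_num)
  have hmono := log_sq_div_sqrt_antitone h34 ht
  have hlog : Real.log ((2 : ℝ) ^ 34) ≤ 23.5671 := by
    rw [Real.log_pow]
    have := Real.log_two_lt_d9
    push_cast
    linarith
  have hlog0 : 0 ≤ Real.log ((2 : ℝ) ^ 34) := by
    rw [Real.log_pow]; have := Real.log_two_gt_d9; push_cast; positivity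
  have hsq : √((2 : ℝ) ^ 34) = 2 ^ 17 := by
    rw [show ((2 : ℝ) ^ 34) = (2 ^ 17) ^ 2 by norm_num, Real.sqrt_sq (by norm_num)]
  have hval : Real.log ((2 : ℝ) ^ 34) ^ 2 / √((2 : ℝ) ^ 34) ≤ 0.0042375 := by
    rw [hsq, div_le_iff₀ (by positivity)]
    calc Real.log ((2 : ℝ) ^ 34) ^ 2 ≤ (23.5671 : ℝ) ^ 2 := by gcongr
      _ ≤ 0.0042375 * 2 ^ 17 := by norm_num
  have hpi : (3.14 : ℝ) < π := Real.pi_gt_d2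
  have hst : 0 < √t := Real.sqrt_pos.2 ht0
  have hid : √t * Real.log t ^ 2 = t * (Real.log t ^ 2 / √t) := by
    field_simp
    rw [Real.sq_sqrt ht0.le]
    ring
  rw [hid, div_le_iff₀ (by positivity)]
  have hφ : Real.log t ^ 2 / √t ≤ 0.0042375 := hmono.trans hval
  nlinarith

/-! ### `θ` under RH (from Schoenfeld's bound) -/

/-- Under RH: `θ(t) ≥ 0.975 t` for `t ≥ 2¹⁵`. [cite: Schoenfeld1976, §6 (via Nicolas2012 (1.12))] -/
theorem theta_ge_975 (hS : Schoenfeld1976_theta) (hRH : RiemannHypothesis) {t : ℝ}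
    (ht : (2 : ℝ) ^ 15 ≤ t) : 0.975 * t ≤ θ t := by
  have h599 : (599 : ℝ) ≤ t := le_trans (by norm_num) ht
  have h1 := hS hRH t h599
  have h2 := schoenfeld_rel_le_025 ht
  have := (abs_le.1 h1).1
  linarith

/-- Under RH: `θ(t) ≤ 1.025 t` for `t ≥ 2¹⁵`. [cite: Schoenfeld1976, §6 (via Nicolas2012 (1.12))] -/
theorem theta_le_1025 (hS : Schoenfeld1976_theta) (hRH : RiemannHypothesis) {t : ℝ}
    (ht : (2 : ℝ) ^ 15 ≤ t) : θ t ≤ 1.025 * t := by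
  have h599 : (599 : ℝ) ≤ t := le_trans (by norm_num) ht
  have h1 := hS hRH t h599
  have h2 := schoenfeld_rel_le_025 ht
  have := (abs_le.1 h1).2
  linarith

/-- Under RH: `θ(t) ≤ 1.0002 t` for `t ≥ 2³⁴`. [cite: Schoenfeld1976, §6 (via Nicolas2012 (1.12))] -/
theorem theta_le_10002 (hS : Schoenfeld1976_theta) (hRH : RiemannHypothesis) {t : ℝ}
    (ht : (2 : ℝ) ^ 34 ≤ t) : θ t ≤ 1.0002 * t := by
  have h599 : (599 : ℝ) ≤ t := le_trans (by norm_num) ht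
  have h1 := hS hRH t h599
  have h2 := schoenfeld_rel_le_0002 ht
  have := (abs_le.1 h1).2
  linarith

/-- Under RH: `θ(t) ≥ 0.9998 t` for `t ≥ 2³⁴`. [cite: Schoenfeld1976, §6 (via Nicolas2012 (1.12))] -/
theorem theta_ge_9998 (hS : Schoenfeld1976_theta) (hRH : RiemannHypothesis) {t : ℝ}
    (ht : (2 : ℝ) ^ 34 ≤ t) : 0.9998 * t ≤ θ t := by
  have h599 : (599 : ℝ) ≤ t := le_trans (by norm_num) ht
  have h1 := hS hRH t h599
  have h2 := schoenfeld_rel_le_0002 ht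
  have := (abs_le.1 h1).1
  linarith

/-! ### Counting primes in a window from `θ` -/

/-- `θ(n) − θ(y) ≤ #{p prime : y < p ≤ n} · log n` for naturals `y, n`. [folklore] -/
theorem theta_sub_theta_le_card_mul_log (y n : ℕ) :
    θ n - θ y ≤ #((Nat.primesLE n).filter (fun p => y < p)) * Real.log n := by
  classical
  rw [Chebyshev.theta_eq_sum_primesLE_log n, Chebyshev.theta_eq_sum_primesLE_log y]
  have hsplit := (Finset.sum_filter_add_sum_filter_not (Nat.primesLE n) (fun p => y < p)
    (fun p => Real.log p))
  -- the primes `≤ min(n, y)` contribute at most `θ(y)`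
  have h1 : ∑ p ∈ (Nat.primesLE n).filter (fun p => ¬ y < p), Real.log p ≤
      ∑ p ∈ Nat.primesLE y, Real.log p := by
    refine Finset.sum_le_sum_of_subset_of_nonneg ?_ ?_
    · intro p hp
      obtain ⟨hp1, hp2⟩ := Finset.mem_filter.1 hp
      exact Nat.mem_primesLE.2 ⟨not_lt.1 hp2, Nat.prime_of_mem_primesLE hp1⟩
    · intro p hp _
      exact Real.log_nonneg (by exact_mod_cast (Nat.prime_of_mem_primesLE hp).one_lt.le)
  -- each of the others contributes at most `log n`
  have h2 : ∑ p ∈ (Nat.primesLE n).filter (fun p => y < p), Real.log p ≤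
      #((Nat.primesLE n).filter (fun p => y < p)) * Real.log n := by
    rw [← nsmul_eq_mul, ← Finset.sum_const]
    refine Finset.sum_le_sum fun p hp => ?_
    obtain ⟨hp1, -⟩ := Finset.mem_filter.1 hp
    have hp' := Nat.prime_of_mem_primesLE hp1
    exact Real.log_le_log (by exact_mod_cast hp'.pos) (by exact_mod_cast Nat.le_of_mem_primesLE hp1)
  linarith

/-! ### A discrete layer-cake bound for `∑ 1/p²` over a window -/

/-- Telescoping over `Ioc a b`. [folklore] -/
theorem sum_Ioc_telescope (e : ℕ → ℝ) {a b : ℕ} (h : a ≤ b) :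
    ∑ n ∈ Ioc a b, (e n - e (n + 1)) = e (a + 1) - e (b + 1) := by
  induction b, h using Nat.le_induction with
  | base => simp
  | succ b hab ih => rw [Finset.sum_Ioc_succ_top hab, ih]; ring

/-- The weights `d(n) = 1/(n(n+1)) − 1/((n+1)(n+2)) = 2/(n(n+1)(n+2))`. [folklore] -/
theorem weight_eq (n : ℕ) (hn : 1 ≤ n) :
    (1 / ((n : ℝ) * (n + 1)) - 1 / (((n : ℝ) + 1) * (n + 2))) = 2 / ((n : ℝ) * (n + 1) * (n + 2)) := by
  have : (1 : ℝ) ≤ n := by exact_mod_cast hn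
  field_simp
  ring

/-- **Layer cake**: for naturals `y < z`,
`∑_{y < n ≤ z} d(n) · #{p prime : y < p ≤ n} ≤ ∑_{p prime, y < p ≤ z} 1/p²`, where
`d(n) = 1/(n(n+1)) − 1/((n+1)(n+2))` (swap the sums; `∑_{n ≥ p} d(n) ≤ 1/(p(p+1)) ≤ 1/p²`).
[folklore] -/
theorem layer_cake (y z : ℕ) :
    ∑ n ∈ Ioc y z, (1 / ((n : ℝ) * (n + 1)) - 1 / (((n : ℝ) + 1) * (n + 2))) *
        #((Nat.primesLE n).filter (fun p => y < p)) ≤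
      ∑ p ∈ (Nat.primesLE z).filter (fun p => y < p), ((p : ℝ) ^ 2)⁻¹ := by
  classical
  set A := (Nat.primesLE z).filter (fun p => y < p) with hA
  set e : ℕ → ℝ := fun n => 1 / ((n : ℝ) * (n + 1)) with he
  have hd : ∀ n : ℕ, (1 / ((n : ℝ) * (n + 1)) - 1 / (((n : ℝ) + 1) * (n + 2))) = e n - e (n + 1) := by
    intro n
    simp only [he]
    push_cast
    ring_nf
  -- Step 1: `∑_{p ∈ A} ∑_{n ∈ Icc p z} d n = ∑_{n ∈ Ioc y z} d n * #(A ∩ [0, n])`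
  have hswap : ∑ p ∈ A, ∑ n ∈ Icc p z, (e n - e (n + 1)) =
      ∑ n ∈ Ioc y z, ∑ p ∈ A.filter (fun p => p ≤ n), (e n - e (n + 1)) := by
    refine Finset.sum_comm' fun p n => ?_
    simp only [hA, Finset.mem_filter, Nat.mem_primesLE, Finset.mem_Icc, Finset.mem_Ioc]
    constructor
    · rintro ⟨⟨⟨hpz, hp⟩, hyp⟩, hpn, hnz⟩
      exact ⟨⟨⟨⟨hpz, hp⟩, hyp⟩, hpn⟩, lt_of_lt_of_le hyp hpn, hnz⟩
    · rintro ⟨⟨⟨⟨hpz, hp⟩, hyp⟩, hpn⟩, hyn, hnz⟩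
      exact ⟨⟨⟨hpz, hp⟩, hyp⟩, hpn, hnz⟩
  have hfil : ∀ n ∈ Ioc y z, A.filter (fun p => p ≤ n) = (Nat.primesLE n).filter (fun p => y < p) := by
    intro n hn
    rw [Finset.mem_Ioc] at hn
    ext p
    simp only [hA, Finset.mem_filter, Nat.mem_primesLE]
    constructor
    · rintro ⟨⟨⟨-, hp⟩, hyp⟩, hpn⟩
      exact ⟨⟨hpn, hp⟩, hyp⟩
    · rintro ⟨⟨hpn, hp⟩, hyp⟩
      exact ⟨⟨⟨hpn.trans hn.2, hp⟩, hyp⟩, hpn⟩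
  have hinner : ∀ n ∈ Ioc y z, ∑ p ∈ A.filter (fun p => p ≤ n), (e n - e (n + 1)) =
      (e n - e (n + 1)) * #((Nat.primesLE n).filter (fun p => y < p)) := by
    intro n hn
    rw [Finset.sum_const, nsmul_eq_mul, hfil n hn, mul_comm]
  -- Step 2: for `p ∈ A`, `∑_{n ∈ Icc p z} d n = e p - e (z+1) ≤ 1/p²`
  have htel : ∀ p ∈ A, ∑ n ∈ Icc p z, (e n - e (n + 1)) ≤ ((p : ℝ) ^ 2)⁻¹ := by
    intro p hp
    obtain ⟨hp1, hyp⟩ := Finset.mem_filter.1 hp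
    have hp' := Nat.prime_of_mem_primesLE hp1
    have hpz : p ≤ z := Nat.le_of_mem_primesLE hp1
    have hp0 : 1 ≤ p := hp'.one_lt.le
    have hIcc : Icc p z = Ioc (p - 1) z := by
      rw [← Finset.Icc_add_one_left_eq_Ioc, Nat.sub_add_cancel hp0]
    rw [hIcc, sum_Ioc_telescope e (by omega), Nat.sub_add_cancel hp0]
    have hez : 0 ≤ e (z + 1) := by simp only [he]; positivity
    have hpR : (1 : ℝ) ≤ p := by exact_mod_cast hp0
    calc e p - e (z + 1) ≤ e p := by linarith
      _ ≤ ((p : ℝ) ^ 2)⁻¹ := by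
          simp only [he]
          rw [one_div, inv_le_inv₀ (by positivity) (by positivity)]
          nlinarith
  calc ∑ n ∈ Ioc y z, (1 / ((n : ℝ) * (n + 1)) - 1 / (((n : ℝ) + 1) * (n + 2))) *
          #((Nat.primesLE n).filter (fun p => y < p))
      = ∑ n ∈ Ioc y z, (e n - e (n + 1)) * #((Nat.primesLE n).filter (fun p => y < p)) := by
        refine Finset.sum_congr rfl fun n _ => ?_
        rw [hd]
    _ = ∑ n ∈ Ioc y z, ∑ p ∈ A.filter (fun p => p ≤ n), (e n - e (n + 1)) := by
        refine Finset.sum_congr rfl fun n hn => ?_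
        rw [hinner n hn]
    _ = ∑ p ∈ A, ∑ n ∈ Icc p z, (e n - e (n + 1)) := hswap.symm
    _ ≤ ∑ p ∈ A, ((p : ℝ) ^ 2)⁻¹ := Finset.sum_le_sum htel

/-- `∑_{y<n≤z} d(n) = 1/((y+1)(y+2)) − 1/((z+1)(z+2))`. [folklore] -/
theorem sum_weight {y z : ℕ} (hyz : y ≤ z) :
    ∑ n ∈ Ioc y z, (1 / ((n : ℝ) * (n + 1)) - 1 / (((n : ℝ) + 1) * (n + 2))) =
      1 / (((y : ℝ) + 1) * (y + 2)) - 1 / (((z : ℝ) + 1) * (z + 2)) := by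
  have h := sum_Ioc_telescope (fun n : ℕ => 1 / ((n : ℝ) * (n + 1))) hyz
  push_cast at h ⊢
  convert h using 2 <;> ring_nf

/-- `∑_{y<n≤z} n · d(n) = 2/(y+2) − 2/(z+2)`. [folklore] -/
theorem sum_mul_weight {y z : ℕ} (hyz : y ≤ z) :
    ∑ n ∈ Ioc y z, (n : ℝ) * (1 / ((n : ℝ) * (n + 1)) - 1 / (((n : ℝ) + 1) * (n + 2))) =
      2 / ((y : ℝ) + 2) - 2 / ((z : ℝ) + 2) := by
  have h := sum_Ioc_telescope (fun n : ℕ => 2 / ((n : ℝ) + 1)) hyz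
  push_cast at h ⊢
  rw [show (2 : ℝ) / ((y : ℝ) + 2) - 2 / ((z : ℝ) + 2) = 2 / ((y : ℝ) + 1 + 1) - 2 / ((z : ℝ) + 1 + 1) by
    ring_nf]
  rw [← h]
  refine Finset.sum_congr rfl fun n hn => ?_
  have hn1 : (1 : ℝ) ≤ n := by
    rw [Finset.mem_Ioc] at hn
    exact_mod_cast (show 1 ≤ n by omega)
  field_simp
  ring

/-- The elementary inequality behind the window bound: for `y ≥ 32768`,
`0.975 (2/(y+2) − 2/(20y+2)) − 1.025 y (1/((y+1)(y+2)) − 1/((20y+1)(20y+2))) ≥ 0.827/y`.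
[folklore] -/
theorem bracket_ge {y : ℝ} (hy : 32768 ≤ y) :
    0.827 / y ≤ 0.975 * (2 / (y + 2) - 2 / (20 * y + 2)) -
      1.025 * y * (1 / ((y + 1) * (y + 2)) - 1 / ((20 * y + 1) * (20 * y + 2))) := by
  have hy0 : 0 < y := by linarith
  have hA : 2 * 0.99993 / y ≤ 2 / (y + 2) := by
    rw [div_le_div_iff₀ (by positivity) (by positivity)]
    nlinarith
  have hB : 2 / (20 * y + 2) ≤ 0.1 / y := by
    rw [div_le_div_iff₀ (by positivity) (by positivity)]
    nlinarith
  have hC : y * (1 / ((y + 1) * (y + 2))) ≤ 1 / y := by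
    rw [mul_one_div, div_le_div_iff₀ (by positivity) (by positivity)]
    nlinarith
  have hD : 0 ≤ y * (1 / ((20 * y + 1) * (20 * y + 2))) := by positivity
  have hE : 0.827 / y ≤ (0.975 * (2 * 0.99993) - 0.975 * 0.1 - 1.025) / y :=
    div_le_div_of_nonneg_right (by norm_num) hy0.le
  have hE' : (0.975 * (2 * 0.99993) - 0.975 * 0.1 - 1.025) / y =
      0.975 * (2 * 0.99993 / y) - 0.975 * (0.1 / y) - 1.025 * (1 / y) := by ring
  rw [hE'] at hE
  calc 0.827 / y ≤ 0.975 * (2 * 0.99993 / y) - 0.975 * (0.1 / y) - 1.025 * (1 / y) := hE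
    _ ≤ 0.975 * (2 / (y + 2)) - 0.975 * (2 / (20 * y + 2)) -
        1.025 * (y * (1 / ((y + 1) * (y + 2)))) + 1.025 * (y * (1 / ((20 * y + 1) * (20 * y + 2)))) := by
        linarith
    _ = _ := by ring

/-- **The window bound.** Under RH (through Schoenfeld's bound), for a natural `y ≥ 2¹⁵` with
`20 y ≤ P` and `Q ≤ y`: `∑_{Q < p ≤ P} 1/p² ≥ 0.827/(y log(20 y))`.
[cite: Schoenfeld1976, §6 (via Nicolas2012 (1.12))] -/
theorem window_bound (hS : Schoenfeld1976_theta) (hRH : RiemannHypothesis) {y P Q : ℕ}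
    (hy : (2 : ℝ) ^ 15 ≤ y) (hyP : 20 * y ≤ P) (hQy : Q ≤ y) :
    0.827 / (y * Real.log (20 * y)) ≤
      ∑ p ∈ (Nat.primesLE P).filter (fun p => Q < p), ((p : ℝ) ^ 2)⁻¹ := by
  classical
  have hy1R : (32768 : ℝ) ≤ y := le_trans (by norm_num) hy
  have hy1 : 32768 ≤ y := by exact_mod_cast hy1R
  have hy0 : (0 : ℝ) < y := by linarith
  set z := 20 * y with hz
  have hyz : y ≤ z := by omega
  -- restrict to the primes in `(y, z]`
  have hsub : (Nat.primesLE z).filter (fun p => y < p) ⊆ (Nat.primesLE P).filter (fun p => Q < p) := by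
    intro p hp
    obtain ⟨hp1, hyp⟩ := Finset.mem_filter.1 hp
    obtain ⟨hpz, hp'⟩ := Nat.mem_primesLE.1 hp1
    exact Finset.mem_filter.2 ⟨Nat.mem_primesLE.2 ⟨hpz.trans hyP, hp'⟩, lt_of_le_of_lt hQy hyp⟩
  refine le_trans ?_ (Finset.sum_le_sum_of_subset_of_nonneg hsub fun p _ _ => by positivity)
  refine le_trans ?_ (layer_cake y z)
  -- pointwise: `#{y < p ≤ n} ≥ (0.975 n - 1.025 y)/log z`
  have hlogz : 0 < Real.log (20 * y) := Real.log_pos (by linarith)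
  have hcount : ∀ n ∈ Ioc y z,
      (0.975 * n - 1.025 * y) / Real.log (20 * y) ≤ #((Nat.primesLE n).filter (fun p => y < p)) := by
    intro n hn
    rw [Finset.mem_Ioc] at hn
    have hnR : (y : ℝ) + 1 ≤ n := by exact_mod_cast hn.1
    have hnz : (n : ℝ) ≤ 20 * y := by exact_mod_cast hn.2
    have hn15 : (2 : ℝ) ^ 15 ≤ n := by linarith
    have h1 := theta_sub_theta_le_card_mul_log y n
    have h2 := theta_ge_975 hS hRH hn15
    have h3 := theta_le_1025 hS hRH hy
    have hlogn : 0 < Real.log n := Real.log_pos (by linarith)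
    have hlogn' : Real.log n ≤ Real.log (20 * y) := Real.log_le_log (by linarith) hnz
    set c : ℝ := (#((Nat.primesLE n).filter (fun p => y < p)) : ℝ) with hc
    have hc0 : 0 ≤ c := by positivity
    by_cases hneg : (0.975 : ℝ) * n - 1.025 * y ≤ 0
    · exact le_trans (div_nonpos_of_nonpos_of_nonneg hneg hlogz.le) hc0
    push Not at hneg
    rw [div_le_iff₀ hlogz]
    calc 0.975 * n - 1.025 * y ≤ θ n - θ y := by linarith
      _ ≤ c * Real.log n := h1
      _ ≤ c * Real.log (20 * y) := by gcongr
  have hd0 : ∀ n ∈ Ioc y z, 0 ≤ (1 / ((n : ℝ) * (n + 1)) - 1 / (((n : ℝ) + 1) * (n + 2))) := by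
    intro n hn
    rw [Finset.mem_Ioc] at hn
    rw [weight_eq n (by omega)]
    positivity
  calc 0.827 / (y * Real.log (20 * y))
      ≤ ∑ n ∈ Ioc y z, (1 / ((n : ℝ) * (n + 1)) - 1 / (((n : ℝ) + 1) * (n + 2))) *
          ((0.975 * n - 1.025 * y) / Real.log (20 * y)) := by
        -- evaluate the telescoping sums
        have hsum : ∑ n ∈ Ioc y z, (1 / ((n : ℝ) * (n + 1)) - 1 / (((n : ℝ) + 1) * (n + 2))) *
            ((0.975 * n - 1.025 * y) / Real.log (20 * y)) =
            (0.975 * (2 / ((y : ℝ) + 2) - 2 / ((z : ℝ) + 2)) -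
              1.025 * y * (1 / (((y : ℝ) + 1) * (y + 2)) - 1 / (((z : ℝ) + 1) * (z + 2)))) /
              Real.log (20 * y) := by
          rw [← sum_mul_weight hyz, ← sum_weight hyz, Finset.mul_sum, Finset.mul_sum,
            ← Finset.sum_sub_distrib, Finset.sum_div]
          refine Finset.sum_congr rfl fun n _ => ?_
          ring
        rw [hsum, hz]
        push_cast
        rw [show (0.827 : ℝ) / (y * Real.log (20 * y)) = 0.827 / y / Real.log (20 * y) by
          rw [div_div]]
        exact div_le_div_of_nonneg_right (bracket_ge hy1R) hlogz.le
    _ ≤ ∑ n ∈ Ioc y z, (1 / ((n : ℝ) * (n + 1)) - 1 / (((n : ℝ) + 1) * (n + 2))) *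
          #((Nat.primesLE n).filter (fun p => y < p)) := by
        refine Finset.sum_le_sum fun n hn => ?_
        exact mul_le_mul_of_nonneg_left (hcount n hn) (hd0 n hn)

/-! ### The largest prime `P ≥ 2·10¹⁰`: basic facts -/

section largeP

variable {P : ℕ} (hP : (2 * 10 ^ 10 : ℝ) ≤ P)
include hP

/-- `log P ≥ 23.718`. [folklore] -/
theorem logP_ge : (23.718 : ℝ) ≤ Real.log P :=
  (log_2e10_gt.le).trans (Real.log_le_log (by norm_num) hP)

/-- `√P ≥ 141421`. [folklore] -/
theorem sqrtP_ge : (141421 : ℝ) ≤ √(P : ℝ) :=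
  sqrt_2e10_ge.trans (Real.sqrt_le_sqrt hP)

/-- `P ≥ 2³⁴`. [folklore] -/
theorem P_ge_2pow34 : (2 : ℝ) ^ 34 ≤ P := le_trans (by norm_num) hP

/-- `P > 0`. [folklore] -/
theorem P_pos : (0 : ℝ) < P := lt_of_lt_of_le (by norm_num) hP

/-- `√P · √P = P`. [folklore] -/
theorem sq_sqrtP : √(P : ℝ) * √(P : ℝ) = P := Real.mul_self_sqrt (P_pos hP).le

/-- `log √P = (log P)/2`. [folklore] -/
theorem log_sqrtP : Real.log (√(P : ℝ)) = Real.log P / 2 := Real.log_sqrt (P_pos hP).le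

/-- Under RH: `0.9998 P ≤ θ(P) ≤ 1.0002 P`, so `θ(P) > 1` and `log θ(P) > 0`.
[cite: Schoenfeld1976, §6 (via Nicolas2012 (1.12))] -/
theorem thetaP_bounds (hS : Schoenfeld1976_theta) (hRH : RiemannHypothesis) :
    0.9998 * P ≤ θ P ∧ θ P ≤ 1.0002 * P :=
  ⟨theta_ge_9998 hS hRH (P_ge_2pow34 hP), theta_le_10002 hS hRH (P_ge_2pow34 hP)⟩

end largeP

/-! ### The gain from the primes of exponent `≥ 2` (`G`) and from the window (`S`) -/

/-- **Case A** (`Q ≥ 5√P`): `θ(Q)/((θP+θQ) log(θP+θQ)) ≥ 2.36/(√P log P)`.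
[cite: Schoenfeld1976, §6 (via Nicolas2012 (1.12))] -/
theorem gain_caseA (hS : Schoenfeld1976_theta) (hRH : RiemannHypothesis) {P Q : ℕ}
    (hP : (2 * 10 ^ 10 : ℝ) ≤ P) (hQP : Q ≤ P) (hQ : 5 * √(P : ℝ) ≤ Q) :
    2.36 / (√(P : ℝ) * Real.log P) ≤ θ Q / ((θ P + θ Q) * Real.log (θ P + θ Q)) := by
  have hL := logP_ge hP
  have hsP := sqrtP_ge hP
  have hsq := sq_sqrtP hP
  have hP0 := P_pos hP
  obtain ⟨hθP1, hθP2⟩ := thetaP_bounds hP hS hRH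
  have hQ15 : (2 : ℝ) ^ 15 ≤ Q := by nlinarith
  have hθQ1 : 0.975 * Q ≤ θ Q := theta_ge_975 hS hRH hQ15
  have hθQP : θ Q ≤ θ P := Chebyshev.theta_mono (by exact_mod_cast hQP)
  set R := θ P + θ Q with hR
  have hR1 : R ≤ 2.0004 * P := by linarith
  have hRpos : 1 < R := by nlinarith
  have hlogR0 : 0 < Real.log R := Real.log_pos hRpos
  -- `log R ≤ log 2.0004 + log P ≤ 1.0293 log P`
  have hlogR : Real.log R ≤ 1.0293 * Real.log P := by
    have h1 : Real.log R ≤ Real.log (2.0004 * P) := Real.log_le_log (by linarith) hR1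
    rw [Real.log_mul (by norm_num) hP0.ne'] at h1
    have h2 : Real.log (2.0004 : ℝ) ≤ 0.6934 := by
      rw [show (2.0004 : ℝ) = 2 * 1.0002 by norm_num, Real.log_mul (by norm_num) (by norm_num)]
      have := Real.log_two_lt_d9
      have := Real.log_le_sub_one_of_pos (show (0 : ℝ) < 1.0002 by norm_num)
      linarith
    linarith
  rw [div_le_div_iff₀ (by positivity) (by positivity)]
  -- `2.36 · R log R ≤ θQ · √P log P`
  have hRlogR : R * Real.log R ≤ (2.0004 * P) * (1.0293 * Real.log P) :=
    mul_le_mul hR1 hlogR hlogR0.le (by positivity)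
  have hθQ : 4.875 * √(P : ℝ) ≤ θ Q := by linarith
  calc 2.36 * ((θ P + θ Q) * Real.log (θ P + θ Q)) = 2.36 * (R * Real.log R) := by rw [hR]
    _ ≤ 2.36 * ((2.0004 * P) * (1.0293 * Real.log P)) := by gcongr
    _ = (2.36 * 2.0004 * 1.0293) * (√(P : ℝ) * √(P : ℝ)) * Real.log P := by rw [hsq]; ring
    _ ≤ 4.875 * (√(P : ℝ) * √(P : ℝ)) * Real.log P := by gcongr; norm_num
    _ = 4.875 * √(P : ℝ) * (√(P : ℝ) * Real.log P) := by ring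
    _ ≤ θ Q * (√(P : ℝ) * Real.log P) := by gcongr

/-- **Case C, gain from `Q`** (`√P/4 < Q < 5√P`): `θ(Q)/((θP+θQ) log(θP+θQ)) ≥ 0.9747 Q/(P log P)`.
[cite: Schoenfeld1976, §6 (via Nicolas2012 (1.12))] -/
theorem gain_caseC (hS : Schoenfeld1976_theta) (hRH : RiemannHypothesis) {P Q : ℕ}
    (hP : (2 * 10 ^ 10 : ℝ) ≤ P) (hQlo : √(P : ℝ) / 4 < Q) (hQhi : (Q : ℝ) < 5 * √(P : ℝ)) :
    0.9747 * Q / ((P : ℝ) * Real.log P) ≤ θ Q / ((θ P + θ Q) * Real.log (θ P + θ Q)) := by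
  have hL := logP_ge hP
  have hsP := sqrtP_ge hP
  have hsq := sq_sqrtP hP
  have hP0 := P_pos hP
  obtain ⟨hθP1, hθP2⟩ := thetaP_bounds hP hS hRH
  have hQ15 : (2 : ℝ) ^ 15 ≤ Q := by nlinarith
  have hQ0 : (0 : ℝ) < Q := by linarith
  have hθQ1 : 0.975 * Q ≤ θ Q := theta_ge_975 hS hRH hQ15
  -- `θ(Q) ≤ log 4 · Q ≤ 1.3863 · 5 √P ≤ 0.0000491 P`
  have hθQ2 : θ Q ≤ 0.0000491 * P := by
    have h1 : θ Q ≤ Real.log 4 * Q := Chebyshev.theta_le_log4_mul_x hQ0.le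
    have h4 : Real.log 4 ≤ 1.3863 := by
      rw [show (4 : ℝ) = 2 ^ 2 by norm_num, Real.log_pow]
      have := Real.log_two_lt_d9
      push_cast
      linarith
    have h2 : Real.log 4 * Q ≤ 1.3863 * (5 * √(P : ℝ)) :=
      mul_le_mul h4 hQhi.le hQ0.le (by norm_num)
    -- `√P ≤ P/141421`
    have h3 : √(P : ℝ) * 141421 ≤ P :=
      calc √(P : ℝ) * 141421 ≤ √(P : ℝ) * √(P : ℝ) :=
            mul_le_mul_of_nonneg_left hsP (Real.sqrt_nonneg _)
        _ = P := hsq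
    nlinarith
  set R := θ P + θ Q with hR
  have hR1 : R ≤ 1.00025 * P := by linarith
  have hRpos : 1 < R := by nlinarith
  have hlogR0 : 0 < Real.log R := Real.log_pos hRpos
  have hlogR : Real.log R ≤ 1.0000106 * Real.log P := by
    have h1 : Real.log R ≤ Real.log (1.00025 * P) := Real.log_le_log (by linarith) hR1
    rw [Real.log_mul (by norm_num) hP0.ne'] at h1
    have h2 := Real.log_le_sub_one_of_pos (show (0 : ℝ) < 1.00025 by norm_num)
    linarith
  rw [div_le_div_iff₀ (by positivity) (by positivity)]
  have hRlogR : R * Real.log R ≤ (1.00025 * P) * (1.0000106 * Real.log P) :=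
    mul_le_mul hR1 hlogR hlogR0.le (by positivity)
  calc 0.9747 * Q * ((θ P + θ Q) * Real.log (θ P + θ Q)) = 0.9747 * Q * (R * Real.log R) := by
        rw [hR]
    _ ≤ 0.9747 * Q * ((1.00025 * P) * (1.0000106 * Real.log P)) := by gcongr
    _ = (0.9747 * 1.00025 * 1.0000106) * Q * (P * Real.log P) := by ring
    _ ≤ 0.975 * Q * (P * Real.log P) := by gcongr; norm_num
    _ ≤ θ Q * (P * Real.log P) := by gcongr

/-- **Case B, gain from the window** (`Q ≤ √P/4`): `∑_{Q<p≤P} 1/p² ≥ 5.8/(√P log P)` (window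
`(y, 20y]`, `y = ⌊√P/4⌋`). [cite: Schoenfeld1976, §6 (via Nicolas2012 (1.12))] -/
theorem window_caseB (hS : Schoenfeld1976_theta) (hRH : RiemannHypothesis) {P Q : ℕ}
    (hP : (2 * 10 ^ 10 : ℝ) ≤ P) (hQ : (Q : ℝ) ≤ √(P : ℝ) / 4) :
    5.8 / (√(P : ℝ) * Real.log P) ≤
      ∑ p ∈ (Nat.primesLE P).filter (fun p => Q < p), ((p : ℝ) ^ 2)⁻¹ := by
  have hL := logP_ge hP
  have hsP := sqrtP_ge hP
  have hsq := sq_sqrtP hP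
  have hP0 := P_pos hP
  set y := ⌊√(P : ℝ) / 4⌋₊ with hy_def
  have hy1 : (y : ℝ) ≤ √(P : ℝ) / 4 := Nat.floor_le (by positivity)
  have hy2 : (35355 : ℕ) ≤ y := Nat.le_floor (by push_cast; linarith)
  have hy2R : (35355 : ℝ) ≤ y := by exact_mod_cast hy2
  have hy15 : (2 : ℝ) ^ 15 ≤ y := le_trans (by norm_num) hy2R
  have hy0 : (0 : ℝ) < y := by linarith
  have hyP : 20 * y ≤ P := by
    have : (20 * y : ℝ) ≤ P := by nlinarith
    exact_mod_cast this
  have hQy : Q ≤ y := Nat.le_floor hQ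
  have hw := window_bound hS hRH hy15 hyP hQy
  refine le_trans ?_ hw
  -- `y log(20y) ≤ (√P/4)(log 5 + log P/2)`
  have hlog20y : Real.log (20 * y) ≤ 1.6095 + Real.log P / 2 := by
    have h1 : Real.log (20 * y) ≤ Real.log (5 * √(P : ℝ)) :=
      Real.log_le_log (by positivity) (by linarith)
    have h5 : Real.log (5 * √(P : ℝ)) = Real.log 5 + Real.log P / 2 := by
      rw [Real.log_mul (by norm_num) (ne_of_gt (by positivity)), log_sqrtP hP]
    have := Real.log_five_lt_d9
    linarith
  have hlog20y0 : 0 < Real.log (20 * y) := Real.log_pos (by linarith)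
  rw [div_le_div_iff₀ (by positivity) (by positivity)]
  calc 5.8 * (y * Real.log (20 * y)) ≤ 5.8 * ((√(P : ℝ) / 4) * (1.6095 + Real.log P / 2)) := by
        gcongr
    _ ≤ 0.827 * (√(P : ℝ) * Real.log P) := by nlinarith

/-- **Case C, gain from the window** (`√P/4 < Q < 5√P`): `∑_{Q<p≤P} 1/p² ≥ 1.19/(Q log P)`
(window `(Q, 20Q]`). [cite: Schoenfeld1976, §6 (via Nicolas2012 (1.12))] -/
theorem window_caseC (hS : Schoenfeld1976_theta) (hRH : RiemannHypothesis) {P Q : ℕ}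
    (hP : (2 * 10 ^ 10 : ℝ) ≤ P) (hQlo : √(P : ℝ) / 4 < Q) (hQhi : (Q : ℝ) < 5 * √(P : ℝ)) :
    1.19 / ((Q : ℝ) * Real.log P) ≤
      ∑ p ∈ (Nat.primesLE P).filter (fun p => Q < p), ((p : ℝ) ^ 2)⁻¹ := by
  have hL := logP_ge hP
  have hsP := sqrtP_ge hP
  have hsq := sq_sqrtP hP
  have hP0 := P_pos hP
  have hQ15 : (2 : ℝ) ^ 15 ≤ Q := by nlinarith
  have hQ0 : (0 : ℝ) < Q := by linarith
  have hQP : 20 * Q ≤ P := by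
    have : (20 * Q : ℝ) ≤ P := by nlinarith
    exact_mod_cast this
  have hw := window_bound hS hRH hQ15 hQP le_rfl
  refine le_trans ?_ hw
  have hlog20Q : Real.log (20 * Q) ≤ 4.6052 + Real.log P / 2 := by
    have h1 : Real.log (20 * Q) ≤ Real.log (100 * √(P : ℝ)) :=
      Real.log_le_log (by positivity) (by linarith)
    have h5 : Real.log (100 * √(P : ℝ)) = Real.log 100 + Real.log P / 2 := by
      rw [Real.log_mul (by norm_num) (ne_of_gt (by positivity)), log_sqrtP hP]
    have h100 : Real.log (100 : ℝ) ≤ 4.6052 := by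
      rw [show (100 : ℝ) = 10 ^ 2 by norm_num, Real.log_pow]
      have := log_ten_lt
      push_cast
      linarith
    linarith
  have hlog20Q0 : 0 < Real.log (20 * Q) := Real.log_pos (by linarith)
  rw [div_le_div_iff₀ (by positivity) (by positivity)]
  calc 1.19 * (Q * Real.log (20 * Q)) ≤ 1.19 * (Q * (4.6052 + Real.log P / 2)) := by gcongr
    _ ≤ 0.827 * (Q * Real.log P) := by nlinarith

/-! ### The key inequality and the main estimate -/

/-- **Key inequality**: for `P ≥ 2·10¹⁰` and `Q ≤ P`, under RH,
`(2+β)/(√P log P) < ∑_{Q<p≤P} 1/p² + θ(Q)/((θP+θQ) log(θP+θQ))`.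
[cite: Nicolas2012, Prop. 2.1; Schoenfeld1976, §6] -/
theorem key_ineq (hS : Schoenfeld1976_theta) (hRH : RiemannHypothesis) {P Q : ℕ}
    (hP : (2 * 10 ^ 10 : ℝ) ≤ P) (hQP : Q ≤ P) :
    (2 + nicolasBeta) / (√(P : ℝ) * Real.log P) <
      ∑ p ∈ (Nat.primesLE P).filter (fun p => Q < p), ((p : ℝ) ^ 2)⁻¹ +
        θ Q / ((θ P + θ Q) * Real.log (θ P + θ Q)) := by
  have hL := logP_ge hP
  have hsP := sqrtP_ge hP
  have hsq := sq_sqrtP hP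
  have hP0 := P_pos hP
  obtain ⟨hθP1, hθP2⟩ := thetaP_bounds hP hS hRH
  have hden : 0 < √(P : ℝ) * Real.log P := by positivity
  have hE : (2 + nicolasBeta) / (√(P : ℝ) * Real.log P) < 2.1002 / (√(P : ℝ) * Real.log P) :=
    div_lt_div_of_pos_right two_add_nicolasBeta_lt hden
  refine hE.trans_le ?_
  set S := ∑ p ∈ (Nat.primesLE P).filter (fun p => Q < p), ((p : ℝ) ^ 2)⁻¹ with hSdef
  set G := θ Q / ((θ P + θ Q) * Real.log (θ P + θ Q)) with hGdef
  have hS0 : 0 ≤ S := Finset.sum_nonneg fun p _ => by positivity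
  have hG0 : 0 ≤ G := by
    have h1 : 0 ≤ θ Q := Chebyshev.theta_nonneg _
    have h2 : 1 < θ P + θ Q := by nlinarith
    have h3 : 0 < Real.log (θ P + θ Q) := Real.log_pos h2
    positivity
  rcases le_or_gt (5 * √(P : ℝ)) Q with hA | hA
  · -- Case A
    have := gain_caseA hS hRH hP hQP hA
    have h2 : 2.1002 / (√(P : ℝ) * Real.log P) ≤ 2.36 / (√(P : ℝ) * Real.log P) :=
      div_le_div_of_nonneg_right (by norm_num) hden.le
    linarith
  rcases le_or_gt (Q : ℝ) (√(P : ℝ) / 4) with hB | hB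
  · -- Case B
    have := window_caseB hS hRH hP hB
    have h2 : 2.1002 / (√(P : ℝ) * Real.log P) ≤ 5.8 / (√(P : ℝ) * Real.log P) :=
      div_le_div_of_nonneg_right (by norm_num) hden.le
    linarith
  · -- Case C
    have h1 := gain_caseC hS hRH hP hB hA
    have h2 := window_caseC hS hRH hP hB hA
    have hQ0 : (0 : ℝ) < Q := by
      have : (0 : ℝ) < √(P : ℝ) / 4 := by positivity
      linarith
    have hLpos : 0 < Real.log P := by linarith
    -- `0.9747 Q/(P L) + 1.19/(Q L) ≥ 2.1002/(√P L)` : a positive-definite quadratic form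
    have hs0 : 0 < √(P : ℝ) := by linarith
    have hquad : 0 ≤ 0.9747 * (Q : ℝ) ^ 2 - 2.1002 * Q * √(P : ℝ) + 1.19 * √(P : ℝ) ^ 2 := by
      nlinarith [sq_nonneg ((Q : ℝ) - 1.0774 * √(P : ℝ)), hQ0.le, hs0.le]
    have hid : (0.9747 * (Q : ℝ) ^ 2 + 1.19 * P) * √(P : ℝ) - 2.1002 * P * Q =
        √(P : ℝ) * (0.9747 * (Q : ℝ) ^ 2 - 2.1002 * Q * √(P : ℝ) + 1.19 * √(P : ℝ) ^ 2) := by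
      linear_combination (2.1002 * (Q : ℝ) - 1.19 * √(P : ℝ)) * hsq
    have hnum : 2.1002 * (P : ℝ) * Q ≤ (0.9747 * (Q : ℝ) ^ 2 + 1.19 * P) * √(P : ℝ) := by
      nlinarith [mul_nonneg hs0.le hquad]
    have key : 2.1002 / (√(P : ℝ) * Real.log P) ≤
        0.9747 * Q / ((P : ℝ) * Real.log P) + 1.19 / ((Q : ℝ) * Real.log P) := by
      have e1 : 0.9747 * Q / ((P : ℝ) * Real.log P) + 1.19 / ((Q : ℝ) * Real.log P) =
          (0.9747 * (Q : ℝ) ^ 2 + 1.19 * P) / ((P : ℝ) * Q * Real.log P) := by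
        field_simp
      rw [e1, div_le_div_iff₀ (by positivity) (by positivity)]
      nlinarith [mul_le_mul_of_nonneg_right hnum hLpos.le]
    linarith

/-- `∏ (1 − a_i) ≤ exp(−∑ a_i)` for `a_i ≤ 1`. [folklore] -/
theorem prod_one_sub_le_exp_neg_sum {ι : Type*} (s : Finset ι) (a : ι → ℝ)
    (h : ∀ i ∈ s, a i ≤ 1) : ∏ i ∈ s, (1 - a i) ≤ rexp (-∑ i ∈ s, a i) := by
  rw [← Finset.sum_neg_distrib, Real.exp_sum]
  exact Finset.prod_le_prod (fun i hi => by linarith [h i hi]) fun i _ => Real.one_sub_le_exp_neg _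

/-- **Main analytic estimate** (Robin 1984, §3, in the form: NF1 + NF2 ⟹ the colossally abundant
bound). Under RH, granted Nicolas's Mertens bound (`Nicolas2012_logf_lower`) and Schoenfeld's
`θ`-bound (`Schoenfeld1976_theta`): for naturals `Q ≤ P` with `P ≥ 2·10¹⁰`,
`(∏_{p≤P}(1 − 1/p))⁻¹ · ∏_{Q<p≤P}(1 − 1/p²) < e^γ log(θ(P) + θ(Q))`.
[cite: Robin1984, §3 (proof of Thm. 1); Nicolas2012, Prop. 2.1] -/
theorem mertens_prod_lt (hN : Nicolas2012_logf_lower) (hS : Schoenfeld1976_theta)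
    (hRH : RiemannHypothesis) {P Q : ℕ} (hP : (2 * 10 ^ 10 : ℝ) ≤ P) (hQP : Q ≤ P) :
    (∏ p ∈ Nat.primesLE P, (1 - (p : ℝ)⁻¹))⁻¹ *
        ∏ p ∈ (Nat.primesLE P).filter (fun p => Q < p), (1 - ((p : ℝ) ^ 2)⁻¹) <
      rexp eulerMascheroniConstant * Real.log (θ P + θ Q) := by
  have hL := logP_ge hP
  have hP0 := P_pos hP
  obtain ⟨hθP1, hθP2⟩ := thetaP_bounds hP hS hRH
  set S := ∑ p ∈ (Nat.primesLE P).filter (fun p => Q < p), ((p : ℝ) ^ 2)⁻¹ with hSdef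
  set R := θ P + θ Q with hR
  set A := Real.log (θ P) with hA
  set E := (2 + nicolasBeta) / (√(P : ℝ) * Real.log P) with hE
  have hθP0 : 1 < θ P := by nlinarith
  have hA0 : 0 < A := Real.log_pos hθP0
  have hθQ0 : 0 ≤ θ Q := Chebyshev.theta_nonneg _
  have hR1 : 1 < R := by linarith
  have hlogR0 : 0 < Real.log R := Real.log_pos hR1
  -- (1) Nicolas: `∏(1-1/p)⁻¹ ≤ e^γ · A · e^E`
  have h1 : (∏ p ∈ Nat.primesLE P, (1 - (p : ℝ)⁻¹))⁻¹ ≤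
      rexp eulerMascheroniConstant * A * rexp E := by
    have h := hN.prod_le hRH (x := (P : ℝ)) (le_trans (by norm_num) hP)
    rwa [Nat.floor_natCast] at h
  -- (2) `∏(1-1/p²) ≤ e^{-S}`
  have h2 : ∏ p ∈ (Nat.primesLE P).filter (fun p => Q < p), (1 - ((p : ℝ) ^ 2)⁻¹) ≤ rexp (-S) := by
    refine prod_one_sub_le_exp_neg_sum _ _ fun p hp => ?_
    have hp' := Nat.prime_of_mem_primesLE (Finset.mem_filter.1 hp).1
    have : (1 : ℝ) ≤ (p : ℝ) ^ 2 := by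
      have : (1 : ℝ) ≤ p := by exact_mod_cast hp'.one_lt.le
      nlinarith
    exact inv_le_one_of_one_le₀ this
  have hPi0 : 0 ≤ ∏ p ∈ (Nat.primesLE P).filter (fun p => Q < p), (1 - ((p : ℝ) ^ 2)⁻¹) :=
    Finset.prod_nonneg fun p hp => by
      have hp' := Nat.prime_of_mem_primesLE (Finset.mem_filter.1 hp).1
      have : (1 : ℝ) ≤ (p : ℝ) ^ 2 := by
        have : (1 : ℝ) ≤ p := by exact_mod_cast hp'.one_lt.le
        nlinarith
      linarith [inv_le_one_of_one_le₀ this]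
  -- (3) key inequality and (4) `G ≤ log(log R) - log A`
  have h3 := key_ineq hS hRH hP hQP
  have h4 : θ Q / (R * Real.log R) ≤ Real.log (Real.log R) - Real.log A := by
    -- `log R - A = log(1 + θQ/θP) ≥ θQ/R`
    have hθPpos : 0 < θ P := by linarith
    have hRA : Real.log R - A = Real.log (R / θ P) := by
      rw [hA, Real.log_div (by linarith) hθPpos.ne']
    have h5 : θ Q / R ≤ Real.log R - A := by
      rw [hRA]
      have := Real.one_sub_inv_le_log_of_pos (x := R / θ P) (by positivity)
      have e1 : 1 - (R / θ P)⁻¹ = θ Q / R := by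
        rw [hR]
        field_simp
        ring
      linarith
    -- `log(log R) - log A = log(log R / A) ≥ 1 - A/log R = (log R - A)/log R`
    have h6 : (Real.log R - A) / Real.log R ≤ Real.log (Real.log R) - Real.log A := by
      rw [← Real.log_div hlogR0.ne' hA0.ne']
      have := Real.one_sub_inv_le_log_of_pos (x := Real.log R / A) (by positivity)
      have e1 : 1 - (Real.log R / A)⁻¹ = (Real.log R - A) / Real.log R := by
        field_simp
      linarith
    calc θ Q / (R * Real.log R) = θ Q / R / Real.log R := by rw [div_div]
      _ ≤ (Real.log R - A) / Real.log R := div_le_div_of_nonneg_right h5 hlogR0.le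
      _ ≤ Real.log (Real.log R) - Real.log A := h6
  -- (5) `A · exp(E - S) < log R`
  have h7 : A * rexp (E - S) < Real.log R := by
    have h8 : E - S < Real.log (Real.log R) - Real.log A := by
      have := h3
      rw [← hSdef, ← hR] at this
      linarith
    have h9 : rexp (E - S) < Real.log R / A := by
      calc rexp (E - S) < rexp (Real.log (Real.log R) - Real.log A) := Real.exp_lt_exp.2 h8
        _ = Real.log R / A := by rw [Real.exp_sub, Real.exp_log hlogR0, Real.exp_log hA0]
    have := mul_lt_mul_of_pos_left h9 hA0
    rwa [mul_div_cancel₀ _ hA0.ne'] at this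
  -- assemble
  calc (∏ p ∈ Nat.primesLE P, (1 - (p : ℝ)⁻¹))⁻¹ *
        ∏ p ∈ (Nat.primesLE P).filter (fun p => Q < p), (1 - ((p : ℝ) ^ 2)⁻¹)
      ≤ (rexp eulerMascheroniConstant * A * rexp E) * rexp (-S) := by
        calc _ ≤ (rexp eulerMascheroniConstant * A * rexp E) *
              ∏ p ∈ (Nat.primesLE P).filter (fun p => Q < p), (1 - ((p : ℝ) ^ 2)⁻¹) :=
              mul_le_mul_of_nonneg_right h1 hPi0
          _ ≤ (rexp eulerMascheroniConstant * A * rexp E) * rexp (-S) :=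
              mul_le_mul_of_nonneg_left h2 (by positivity)
    _ = rexp eulerMascheroniConstant * (A * rexp (E - S)) := by
        rw [Real.exp_sub, Real.exp_neg]; ring
    _ < rexp eulerMascheroniConstant * Real.log R :=
        mul_lt_mul_of_pos_left h7 (Real.exp_pos _)

/-! ### Below the threshold: `P < 2·10¹⁰` forces `N ≤ 10^(10^10)` -/

/-- Under RH: if `2 ≤ P < 2·10¹⁰` then `θ(P) + √u log u ≤ 10¹⁰ log 10` for
`u = (2P+1) log(2P)/log 2` (so a colossally abundant number with largest prime `P` is at most
`10^(10^10)`, by `Nat.IsCAParameter.log_le_theta_add`). [cite: Schoenfeld1976, §6 (via Nicolas2012 (1.12))] -/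
theorem theta_add_size_le (hS : Schoenfeld1976_theta) (hRH : RiemannHypothesis) {P : ℕ}
    (hP2 : 2 ≤ P) (hP : (P : ℝ) < 2 * 10 ^ 10) :
    θ P + √((2 * P + 1) * Real.log (2 * P) / Real.log 2) *
        Real.log ((2 * P + 1) * Real.log (2 * P) / Real.log 2) ≤ 10 ^ 10 * Real.log 10 := by
  have hP2R : (2 : ℝ) ≤ P := by exact_mod_cast hP2
  have hlog2 := Real.log_two_gt_d9
  have hlog2' := Real.log_two_lt_d9
  have hl10 := log_ten_gt
  have hl10' := log_ten_lt
  -- `θ(P) ≤ θ(2·10¹⁰) ≤ 1.0002 · 2·10¹⁰`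
  have hθ : θ P ≤ 1.0002 * (2 * 10 ^ 10) :=
    (Chebyshev.theta_mono hP.le).trans (theta_le_10002 hS hRH (by norm_num))
  set u : ℝ := (2 * P + 1) * Real.log (2 * P) / Real.log 2 with hu
  -- `1 ≤ u ≤ 1.44·10¹²`
  have hlog2P : Real.log 2 ≤ Real.log (2 * P) := Real.log_le_log (by norm_num) (by linarith)
  have hlog2P' : Real.log (2 * P) ≤ 24.4122 := by
    have h1 : Real.log (2 * P) ≤ Real.log (4 * 10 ^ 10) := Real.log_le_log (by positivity) (by linarith)
    have h2 : Real.log (4 * 10 ^ 10 : ℝ) = 2 * Real.log 2 + 10 * Real.log 10 := by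
      rw [show (4 * 10 ^ 10 : ℝ) = 2 ^ 2 * 10 ^ 10 by norm_num, Real.log_mul (by norm_num) (by norm_num),
        Real.log_pow, Real.log_pow]
      push_cast
      ring
    linarith
  have hu1 : 1 ≤ u := by
    rw [hu, le_div_iff₀ (by linarith), one_mul]
    calc Real.log 2 ≤ 1 * Real.log (2 * P) := by linarith
      _ ≤ (2 * P + 1) * Real.log (2 * P) := by gcongr <;> linarith
  have hu2 : u ≤ 1.44 * 10 ^ 12 := by
    rw [hu, div_le_iff₀ (by linarith)]
    have h1 : (2 * (P : ℝ) + 1) * Real.log (2 * P) ≤ (4 * 10 ^ 10 + 1) * 24.4122 :=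
      mul_le_mul (by linarith) hlog2P' (by linarith) (by norm_num)
    nlinarith
  have hu0 : 0 < u := by linarith
  -- `√u log u ≤ 1.2·10⁶ · 28.1`
  have hsqrt : √u ≤ 1.2 * 10 ^ 6 := by
    rw [show (1.2 * 10 ^ 6 : ℝ) = √((1.2 * 10 ^ 6) ^ 2) by rw [Real.sqrt_sq (by norm_num)]]
    exact Real.sqrt_le_sqrt (by nlinarith)
  have hlogu : Real.log u ≤ 28.1 := by
    have h1 : Real.log u ≤ Real.log (1.44 * 10 ^ 12) := Real.log_le_log hu0 hu2
    have h2 : Real.log (1.44 * 10 ^ 12 : ℝ) = Real.log 1.44 + 12 * Real.log 10 := by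
      rw [Real.log_mul (by norm_num) (by norm_num), Real.log_pow]
      push_cast
      ring
    have h3 := Real.log_le_sub_one_of_pos (show (0 : ℝ) < 1.44 by norm_num)
    linarith
  have hlogu0 : 0 ≤ Real.log u := Real.log_nonneg hu1
  have hsl : √u * Real.log u ≤ 1.2 * 10 ^ 6 * 28.1 :=
    mul_le_mul hsqrt hlogu hlogu0 (by norm_num)
  linarith

/-- `log N ≤ k log 10 ⟹ N ≤ 10^k` for naturals (no evaluation of the power). [folklore] -/
theorem nat_le_ten_pow_of_log_le {N k : ℕ} (h : Real.log N ≤ k * Real.log 10) : N ≤ 10 ^ k := by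
  rcases Nat.eq_zero_or_pos N with rfl | hN
  · exact Nat.zero_le _
  have hNR : (0 : ℝ) < N := by exact_mod_cast hN
  have h1 : (N : ℝ) ≤ (10 : ℝ) ^ k := by
    calc (N : ℝ) = rexp (Real.log N) := (Real.exp_log hNR).symm
      _ ≤ rexp (k * Real.log 10) := Real.exp_le_exp.2 h
      _ = (10 : ℝ) ^ k := by rw [Real.exp_nat_mul, Real.exp_log (by norm_num)]
  exact_mod_cast h1

end RobinAnalytic

end Literature.NumberTheory.LFunctions

end
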